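import Summits.BirchSwinnertonDyer.BirchSwinnertonDyer.Theorems.SignedLowerHalvesSprungLowerHalfAtThreeSelmerNineShape
import Summits.BirchSwinnertonDyer.Rank1Residual.Supersingular.RankZeroSurjThreeCertificates_02
import HarnessLib

/-!
# Route `SignedLowerHalves`, crux `SprungLowerHalfAtThree` (item stmt-BirchSwinnertonDyer-19003), its LEAF
# BRANCH `r_an = 0 ∧ surj(3)` PER PAIR — RECORDS part C of 4: `BSD(E,3)` for `14170s1`, `15074a1`, `15152a1`, `15344i1`, `15622a1`, `15650p1`, `15680ba1`, `15680bb1`, `15680y1`, `15686f1`, `16019a1`, `16562r1`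
# from PUBLISHED facts + the landed two-engine `3`-descent rows (cell `bsd-ssimc`, seat `bsd-ssimc-k3-c5`
# gen 5; a `--supports … --as helper` file; closes nothing about the crux)

PARTITION (cell bsd-ssimc): X8 (A8) × 12 of the 49 window cells `r_an = 0 ∧ surj(3) ∧ ord₃ #Ш_an = 2`
(all 49 have `N < 2·10⁴`; 48 of them carried ONLY the K25-conditional offer `bsdp_x8r0kp3_*` before, and
`11123a1` — crux 5's BC5 «first value» pair — carried no `BSDp` theorem at all) — closes PER PAIR (OFFERS;
the desk books, nothing is booked here); types nothing new; crux 5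
(`Summit.BirchSwinnertonDyer.BirchSwinnertonDyer.Theses.SignedLowerHalves.SprungLowerHalfAtThree`) stays OPEN
(clause (A) = modularity, `…Characterization.lean`). HONEST FRAMING: BSD is not proved by any of this;
nothing here is new mathematics — the road is cell `b2b-bsdres`'s (consumer
`Supersingular.X8.bsdp_rankZero_of_casselsTate_of_selmerGroup_ne_bot_of_surj`, `DescentLowerBound.lean`;
rows `Supersingular/X8DescentRecords.lean`, x10b gen 5, kit j091546: engine 1 = x11b `desc3lib.gp` EXACT-3,
engine 2 = `desc3full_e2.py`, `dim_𝔽₃ Sel^(3)(E/ℚ) = 2` on both, same `𝔽₃`-subspace of `A^×/A^{×3}`);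
this seat only types the per-pair theorems that were never written off those rows. THEOREMS ONLY (no
definition, no named fact, no `sorry`).

Each record instantiates `X8.bsdp_three_rankZero_of_ainvs_of_selmerGroup_ne_bot_of_surj` (`…SelmerNineShape.lean`)
on the literal Cremona model: global minimality (bounded Kraus criterion), `3 ∤ Δ` and `#Ẽ(𝔽₃) ∈ {1, 7}`
are DECIDED by the kernel; `ρ̄_{E,3}` onto is the landed certificate `surj_x8r0_<label>_3`
(`RankZeroSurjThreeCertificates_0*`). What REMAINS displayed: the PUBLISHED named facts `hCT`
(Cassels–Tate), `hW` (Wuthrich 2014 Prop. 21), `hGZK`, `hmod`; per pair `hr` (`r_an = 0`, Cremona),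
`hq`/`hv` (`#Ш_an = q`, `ord₃ q ≤ 2`; here `#Ш_an = 9`), and the certificate line `hSel : Sel^(3)(E/ℚ) ≠ ⊥`
whose EVIDENCE is the landed row named in each docstring (`checked_x8_rankZero_sha9_desc3_k`, cert sha256
prefix) — the same tier as the tree's other flag-free per-pair A8 theorems (`bsdp3_b1n_*`, `bsdp3_nn*`).
Mathematics of the chain (all PROVED in the tree below the named facts): `r = 0` (GZK) and `E(ℚ)[3] = 0`
(`E[3]` irreducible on X8) make `Sel^(3)(E/ℚ) ↪ Ш[3]`, so `Ш[3] ≠ 0`, `3 ∣ #Ш`, `9 ∣ #Ш` (Cassels–Tate) =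
`ord₃ #Ш_an ≤ ord₃ #Ш`; Wuthrich's Prop. 21 (image onto) gives `≥`.

References: [Wuthrich2014] Prop. 21; [SilvermanAEC2009] Thm. X.4.14, VII.1 Rem. 1.1, VII.5 Prop. 5.1(a);
[Serre1972] §1.11 Prop. 12, §2.4 Prop. 15; [Miller2011LMS] Def. 1.1; [Cremona2006] Table 1; Schaefer–Stoll,
Trans. AMS 356 (2004) (the descent engines' method).
-/

set_option autoImplicit false
set_option linter.dupNamespace false

noncomputable section

open scoped Classical

open WeierstrassCurve Literature.NumberTheory.EllipticCurves
  Literature.NumberTheory.EllipticCurves.Rank1Residual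
  Literature.NumberTheory.EllipticCurves.Rank1Residual.Typed
  Literature.NumberTheory.EllipticCurves.Rank1Residual.X11RankOneCertificates
  Literature.NumberTheory.EllipticCurves.Wuthrich2014
  Summit.BirchSwinnertonDyer.BirchSwinnertonDyer.Rank1Residual.X11RankOne
  Summit.BirchSwinnertonDyer.Rank1Residual.Supersingular

namespace Summit.BirchSwinnertonDyer.BirchSwinnertonDyer.Theorems

/-- **`BSD(E,3)` for `14170s1`** — X8 ∩ {r_an = 0} ∩ {surj(3)}, `#Ш_an = 9`; Cremona model `[1,-1,1,-806322,-281065679]`,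
`N = 14170 = 2·5·13·109`, good supersingular at `3` with `a₃ = 3`, `ρ̄_{E,3}` onto (`surj_x8r0_14170s1_3`), `#E(ℚ)_tors = 1`,
`∏ c_ℓ = 14`. Kernel-decided: global minimality (the bounded Kraus certificate of `surj_x8r0_14170s1_3`, verbatim), `3 ∤ Δ`, `#Ẽ(𝔽₃) = 1`. Binders: PUBLISHED `hCT`,
`hW`, `hGZK`, `hmod`; per pair `hr`, `hq`/`hv` (`#Ш_an = 9`), `hSel : Sel^(3)(E/ℚ) ≠ ⊥` — EVIDENCE: the landed
two-engine exact `3`-descent row of `14170s1` in `Supersingular/X8DescentRecords.lean` (`checked_x8_rankZero_sha9_desc3_3`;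
`dim_𝔽₃ Sel^(3) = 2` on both engines, same subspace; cert `371db38fc860…`; kit j091546). Per pair; OFFER (the
desk books); class X8 and crux 5 unchanged. [cite: Wuthrich2014, Prop. 21 (p. 400)]
[cite: SilvermanAEC2009, Thm. X.4.14 and VII.1 Remark 1.1] [cite: Miller2011LMS, §1 and Def. 1.1]
[cite: Cremona2006, Table 1 (Cremona label 14170s1)] -/
theorem X8.bsdp3_sel9_14170s1 (hCT : exists_casselsTate_pairing (K := ℚ)) (hW : sha_dvd_analyticSha)
    (hGZK : rank_eq_analyticRank_of_analyticRank_le_one) (hmod : hasEntireLFunction_rat)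
    (W : WeierstrassCurve ℚ) (hWm : W = ⟨1, -1, 1, -806322, -281065679⟩) (hr : W.analyticRank = 0)
    {q : ℚ} (hq : shaAn W = (q : ℂ)) (hv : padicValRat 3 q ≤ 2) (hSel : W.selmerGroup (3 : ℤ) ≠ ⊥) :
    BSDp W 3 := by
  subst hWm
  exact X8.bsdp_three_rankZero_of_ainvs_of_selmerGroup_ne_bot_of_surj hCT hW hGZK hmod
    1 (-1) 1 (-806322) (-281065679)
    (isGloballyMinimal_of_krausCriterion_bounded 1 (-1) 1 (-806322) (-281065679)
      (by decide +kernel) (by decide +kernel) (by decide +kernel))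
    (by decide) (n₃ := 1) (by decide +kernel) (by decide) surj_x8r0_14170s1_3 hr hq hv hSel

/-- **`BSD(E,3)` for `15074a1`** — X8 ∩ {r_an = 0} ∩ {surj(3)}, `#Ш_an = 9`; Cremona model `[1,-1,0,-367810,-85766636]`,
`N = 15074 = 2·7537`, good supersingular at `3` with `a₃ = −3`, `ρ̄_{E,3}` onto (`surj_x8r0_15074a1_3`), `#E(ℚ)_tors = 1`,
`∏ c_ℓ = 1`. Kernel-decided: global minimality (the bounded Kraus certificate of `surj_x8r0_15074a1_3`, verbatim), `3 ∤ Δ`, `#Ẽ(𝔽₃) = 7`. Binders: PUBLISHED `hCT`,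
`hW`, `hGZK`, `hmod`; per pair `hr`, `hq`/`hv` (`#Ш_an = 9`), `hSel : Sel^(3)(E/ℚ) ≠ ⊥` — EVIDENCE: the landed
two-engine exact `3`-descent row of `15074a1` in `Supersingular/X8DescentRecords.lean` (`checked_x8_rankZero_sha9_desc3_3`;
`dim_𝔽₃ Sel^(3) = 2` on both engines, same subspace; cert `b518a2f608dd…`; kit j091546). Per pair; OFFER (the
desk books); class X8 and crux 5 unchanged. [cite: Wuthrich2014, Prop. 21 (p. 400)]
[cite: SilvermanAEC2009, Thm. X.4.14 and VII.1 Remark 1.1] [cite: Miller2011LMS, §1 and Def. 1.1]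
[cite: Cremona2006, Table 1 (Cremona label 15074a1)] -/
theorem X8.bsdp3_sel9_15074a1 (hCT : exists_casselsTate_pairing (K := ℚ)) (hW : sha_dvd_analyticSha)
    (hGZK : rank_eq_analyticRank_of_analyticRank_le_one) (hmod : hasEntireLFunction_rat)
    (W : WeierstrassCurve ℚ) (hWm : W = ⟨1, -1, 0, -367810, -85766636⟩) (hr : W.analyticRank = 0)
    {q : ℚ} (hq : shaAn W = (q : ℂ)) (hv : padicValRat 3 q ≤ 2) (hSel : W.selmerGroup (3 : ℤ) ≠ ⊥) :
    BSDp W 3 := by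
  subst hWm
  exact X8.bsdp_three_rankZero_of_ainvs_of_selmerGroup_ne_bot_of_surj hCT hW hGZK hmod
    1 (-1) 0 (-367810) (-85766636)
    (isGloballyMinimal_of_krausCriterion_bounded 1 (-1) 0 (-367810) (-85766636)
      (by decide +kernel) (by decide +kernel) (by decide +kernel))
    (by decide) (n₃ := 7) (by decide +kernel) (by decide) surj_x8r0_15074a1_3 hr hq hv hSel

/-- **`BSD(E,3)` for `15152a1`** — X8 ∩ {r_an = 0} ∩ {surj(3)}, `#Ш_an = 9`; Cremona model `[0,0,0,-124,-532]`,
`N = 15152 = 2⁴·947`, good supersingular at `3` with `a₃ = 3`, `ρ̄_{E,3}` onto (`surj_x8r0_15152a1_3`), `#E(ℚ)_tors = 1`,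
`∏ c_ℓ = 1`. Kernel-decided: global minimality (the bounded Kraus certificate of `surj_x8r0_15152a1_3`, verbatim), `3 ∤ Δ`, `#Ẽ(𝔽₃) = 1`. Binders: PUBLISHED `hCT`,
`hW`, `hGZK`, `hmod`; per pair `hr`, `hq`/`hv` (`#Ш_an = 9`), `hSel : Sel^(3)(E/ℚ) ≠ ⊥` — EVIDENCE: the landed
two-engine exact `3`-descent row of `15152a1` in `Supersingular/X8DescentRecords.lean` (`checked_x8_rankZero_sha9_desc3_3`;
`dim_𝔽₃ Sel^(3) = 2` on both engines, same subspace; cert `a7044bbf6db1…`; kit j091546). Per pair; OFFER (the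
desk books); class X8 and crux 5 unchanged. [cite: Wuthrich2014, Prop. 21 (p. 400)]
[cite: SilvermanAEC2009, Thm. X.4.14 and VII.1 Remark 1.1] [cite: Miller2011LMS, §1 and Def. 1.1]
[cite: Cremona2006, Table 1 (Cremona label 15152a1)] -/
theorem X8.bsdp3_sel9_15152a1 (hCT : exists_casselsTate_pairing (K := ℚ)) (hW : sha_dvd_analyticSha)
    (hGZK : rank_eq_analyticRank_of_analyticRank_le_one) (hmod : hasEntireLFunction_rat)
    (W : WeierstrassCurve ℚ) (hWm : W = ⟨0, 0, 0, -124, -532⟩) (hr : W.analyticRank = 0)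
    {q : ℚ} (hq : shaAn W = (q : ℂ)) (hv : padicValRat 3 q ≤ 2) (hSel : W.selmerGroup (3 : ℤ) ≠ ⊥) :
    BSDp W 3 := by
  subst hWm
  exact X8.bsdp_three_rankZero_of_ainvs_of_selmerGroup_ne_bot_of_surj hCT hW hGZK hmod
    0 0 0 (-124) (-532)
    (isGloballyMinimal_of_krausCriterion_bounded 0 0 0 (-124) (-532)
      (by decide +kernel) (by decide +kernel) (by decide +kernel))
    (by decide) (n₃ := 1) (by decide +kernel) (by decide) surj_x8r0_15152a1_3 hr hq hv hSel

/-- **`BSD(E,3)` for `15344i1`** — X8 ∩ {r_an = 0} ∩ {surj(3)}, `#Ш_an = 9`; Cremona model `[0,0,0,-97,-2077]`,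
`N = 15344 = 2⁴·7·137`, good supersingular at `3` with `a₃ = 3`, `ρ̄_{E,3}` onto (`surj_x8r0_15344i1_3`), `#E(ℚ)_tors = 1`,
`∏ c_ℓ = 1`. Kernel-decided: global minimality (the bounded Kraus certificate of `surj_x8r0_15344i1_3`, verbatim), `3 ∤ Δ`, `#Ẽ(𝔽₃) = 1`. Binders: PUBLISHED `hCT`,
`hW`, `hGZK`, `hmod`; per pair `hr`, `hq`/`hv` (`#Ш_an = 9`), `hSel : Sel^(3)(E/ℚ) ≠ ⊥` — EVIDENCE: the landed
two-engine exact `3`-descent row of `15344i1` in `Supersingular/X8DescentRecords.lean` (`checked_x8_rankZero_sha9_desc3_3`;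
`dim_𝔽₃ Sel^(3) = 2` on both engines, same subspace; cert `edba3db8f045…`; kit j091546). Per pair; OFFER (the
desk books); class X8 and crux 5 unchanged. [cite: Wuthrich2014, Prop. 21 (p. 400)]
[cite: SilvermanAEC2009, Thm. X.4.14 and VII.1 Remark 1.1] [cite: Miller2011LMS, §1 and Def. 1.1]
[cite: Cremona2006, Table 1 (Cremona label 15344i1)] -/
theorem X8.bsdp3_sel9_15344i1 (hCT : exists_casselsTate_pairing (K := ℚ)) (hW : sha_dvd_analyticSha)
    (hGZK : rank_eq_analyticRank_of_analyticRank_le_one) (hmod : hasEntireLFunction_rat)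
    (W : WeierstrassCurve ℚ) (hWm : W = ⟨0, 0, 0, -97, -2077⟩) (hr : W.analyticRank = 0)
    {q : ℚ} (hq : shaAn W = (q : ℂ)) (hv : padicValRat 3 q ≤ 2) (hSel : W.selmerGroup (3 : ℤ) ≠ ⊥) :
    BSDp W 3 := by
  subst hWm
  exact X8.bsdp_three_rankZero_of_ainvs_of_selmerGroup_ne_bot_of_surj hCT hW hGZK hmod
    0 0 0 (-97) (-2077)
    (isGloballyMinimal_of_krausCriterion_bounded 0 0 0 (-97) (-2077)
      (by decide +kernel) (by decide +kernel) (by decide +kernel))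
    (by decide) (n₃ := 1) (by decide +kernel) (by decide) surj_x8r0_15344i1_3 hr hq hv hSel

/-- **`BSD(E,3)` for `15622a1`** — X8 ∩ {r_an = 0} ∩ {surj(3)}, `#Ш_an = 9`; Cremona model `[1,-1,0,-4033,-97603]`,
`N = 15622 = 2·73·107`, good supersingular at `3` with `a₃ = 3`, `ρ̄_{E,3}` onto (`surj_x8r0_15622a1_3`), `#E(ℚ)_tors = 1`,
`∏ c_ℓ = 2`. Kernel-decided: global minimality (the bounded Kraus certificate of `surj_x8r0_15622a1_3`, verbatim), `3 ∤ Δ`, `#Ẽ(𝔽₃) = 1`. Binders: PUBLISHED `hCT`,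
`hW`, `hGZK`, `hmod`; per pair `hr`, `hq`/`hv` (`#Ш_an = 9`), `hSel : Sel^(3)(E/ℚ) ≠ ⊥` — EVIDENCE: the landed
two-engine exact `3`-descent row of `15622a1` in `Supersingular/X8DescentRecords.lean` (`checked_x8_rankZero_sha9_desc3_3`;
`dim_𝔽₃ Sel^(3) = 2` on both engines, same subspace; cert `a781c96404e1…`; kit j091546). Per pair; OFFER (the
desk books); class X8 and crux 5 unchanged. [cite: Wuthrich2014, Prop. 21 (p. 400)]
[cite: SilvermanAEC2009, Thm. X.4.14 and VII.1 Remark 1.1] [cite: Miller2011LMS, §1 and Def. 1.1]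
[cite: Cremona2006, Table 1 (Cremona label 15622a1)] -/
theorem X8.bsdp3_sel9_15622a1 (hCT : exists_casselsTate_pairing (K := ℚ)) (hW : sha_dvd_analyticSha)
    (hGZK : rank_eq_analyticRank_of_analyticRank_le_one) (hmod : hasEntireLFunction_rat)
    (W : WeierstrassCurve ℚ) (hWm : W = ⟨1, -1, 0, -4033, -97603⟩) (hr : W.analyticRank = 0)
    {q : ℚ} (hq : shaAn W = (q : ℂ)) (hv : padicValRat 3 q ≤ 2) (hSel : W.selmerGroup (3 : ℤ) ≠ ⊥) :
    BSDp W 3 := by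
  subst hWm
  exact X8.bsdp_three_rankZero_of_ainvs_of_selmerGroup_ne_bot_of_surj hCT hW hGZK hmod
    1 (-1) 0 (-4033) (-97603)
    (isGloballyMinimal_of_krausCriterion_bounded 1 (-1) 0 (-4033) (-97603)
      (by decide +kernel) (by decide +kernel) (by decide +kernel))
    (by decide) (n₃ := 1) (by decide +kernel) (by decide) surj_x8r0_15622a1_3 hr hq hv hSel

/-- **`BSD(E,3)` for `15650p1`** — X8 ∩ {r_an = 0} ∩ {surj(3)}, `#Ш_an = 9`; Cremona model `[1,-1,1,1350,-27653]`,
`N = 15650 = 2·5²·313`, good supersingular at `3` with `a₃ = 3`, `ρ̄_{E,3}` onto (`surj_x8r0_15650p1_3`), `#E(ℚ)_tors = 1`,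
`∏ c_ℓ = 2`. Kernel-decided: global minimality (the bounded Kraus certificate of `surj_x8r0_15650p1_3`, verbatim), `3 ∤ Δ`, `#Ẽ(𝔽₃) = 1`. Binders: PUBLISHED `hCT`,
`hW`, `hGZK`, `hmod`; per pair `hr`, `hq`/`hv` (`#Ш_an = 9`), `hSel : Sel^(3)(E/ℚ) ≠ ⊥` — EVIDENCE: the landed
two-engine exact `3`-descent row of `15650p1` in `Supersingular/X8DescentRecords.lean` (`checked_x8_rankZero_sha9_desc3_3`;
`dim_𝔽₃ Sel^(3) = 2` on both engines, same subspace; cert `6f147ec3424a…`; kit j091546). Per pair; OFFER (the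
desk books); class X8 and crux 5 unchanged. [cite: Wuthrich2014, Prop. 21 (p. 400)]
[cite: SilvermanAEC2009, Thm. X.4.14 and VII.1 Remark 1.1] [cite: Miller2011LMS, §1 and Def. 1.1]
[cite: Cremona2006, Table 1 (Cremona label 15650p1)] -/
theorem X8.bsdp3_sel9_15650p1 (hCT : exists_casselsTate_pairing (K := ℚ)) (hW : sha_dvd_analyticSha)
    (hGZK : rank_eq_analyticRank_of_analyticRank_le_one) (hmod : hasEntireLFunction_rat)
    (W : WeierstrassCurve ℚ) (hWm : W = ⟨1, -1, 1, 1350, -27653⟩) (hr : W.analyticRank = 0)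
    {q : ℚ} (hq : shaAn W = (q : ℂ)) (hv : padicValRat 3 q ≤ 2) (hSel : W.selmerGroup (3 : ℤ) ≠ ⊥) :
    BSDp W 3 := by
  subst hWm
  exact X8.bsdp_three_rankZero_of_ainvs_of_selmerGroup_ne_bot_of_surj hCT hW hGZK hmod
    1 (-1) 1 1350 (-27653)
    (isGloballyMinimal_of_krausCriterion_bounded 1 (-1) 1 1350 (-27653)
      (by decide +kernel) (by decide +kernel) (by decide +kernel))
    (by decide) (n₃ := 1) (by decide +kernel) (by decide) surj_x8r0_15650p1_3 hr hq hv hSel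

/-- **`BSD(E,3)` for `15680ba1`** — X8 ∩ {r_an = 0} ∩ {surj(3)}, `#Ш_an = 9`; Cremona model `[0,0,0,-8428,-297808]`,
`N = 15680 = 2⁶·5·7²`, good supersingular at `3` with `a₃ = 3`, `ρ̄_{E,3}` onto (`surj_x8r0_15680ba1_3`), `#E(ℚ)_tors = 1`,
`∏ c_ℓ = 2`. Kernel-decided: global minimality (the bounded Kraus certificate of `surj_x8r0_15680ba1_3`, verbatim), `3 ∤ Δ`, `#Ẽ(𝔽₃) = 1`. Binders: PUBLISHED `hCT`,
`hW`, `hGZK`, `hmod`; per pair `hr`, `hq`/`hv` (`#Ш_an = 9`), `hSel : Sel^(3)(E/ℚ) ≠ ⊥` — EVIDENCE: the landed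
two-engine exact `3`-descent row of `15680ba1` in `Supersingular/X8DescentRecords.lean` (`checked_x8_rankZero_sha9_desc3_3`;
`dim_𝔽₃ Sel^(3) = 2` on both engines, same subspace; cert `3f8aa25c75e9…`; kit j091546). Per pair; OFFER (the
desk books); class X8 and crux 5 unchanged. [cite: Wuthrich2014, Prop. 21 (p. 400)]
[cite: SilvermanAEC2009, Thm. X.4.14 and VII.1 Remark 1.1] [cite: Miller2011LMS, §1 and Def. 1.1]
[cite: Cremona2006, Table 1 (Cremona label 15680ba1)] -/
theorem X8.bsdp3_sel9_15680ba1 (hCT : exists_casselsTate_pairing (K := ℚ)) (hW : sha_dvd_analyticSha)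
    (hGZK : rank_eq_analyticRank_of_analyticRank_le_one) (hmod : hasEntireLFunction_rat)
    (W : WeierstrassCurve ℚ) (hWm : W = ⟨0, 0, 0, -8428, -297808⟩) (hr : W.analyticRank = 0)
    {q : ℚ} (hq : shaAn W = (q : ℂ)) (hv : padicValRat 3 q ≤ 2) (hSel : W.selmerGroup (3 : ℤ) ≠ ⊥) :
    BSDp W 3 := by
  subst hWm
  exact X8.bsdp_three_rankZero_of_ainvs_of_selmerGroup_ne_bot_of_surj hCT hW hGZK hmod
    0 0 0 (-8428) (-297808)
    (isGloballyMinimal_of_krausCriterion_bounded 0 0 0 (-8428) (-297808)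
      (by decide +kernel) (by decide +kernel) (by decide +kernel))
    (by decide) (n₃ := 1) (by decide +kernel) (by decide) surj_x8r0_15680ba1_3 hr hq hv hSel

/-- **`BSD(E,3)` for `15680bb1`** — X8 ∩ {r_an = 0} ∩ {surj(3)}, `#Ш_an = 9`; Cremona model `[0,0,0,6272,-581728]`,
`N = 15680 = 2⁶·5·7²`, good supersingular at `3` with `a₃ = 3`, `ρ̄_{E,3}` onto (`surj_x8r0_15680bb1_3`), `#E(ℚ)_tors = 1`,
`∏ c_ℓ = 2`. Kernel-decided: global minimality (the bounded Kraus certificate of `surj_x8r0_15680bb1_3`, verbatim), `3 ∤ Δ`, `#Ẽ(𝔽₃) = 1`. Binders: PUBLISHED `hCT`,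
`hW`, `hGZK`, `hmod`; per pair `hr`, `hq`/`hv` (`#Ш_an = 9`), `hSel : Sel^(3)(E/ℚ) ≠ ⊥` — EVIDENCE: the landed
two-engine exact `3`-descent row of `15680bb1` in `Supersingular/X8DescentRecords.lean` (`checked_x8_rankZero_sha9_desc3_3`;
`dim_𝔽₃ Sel^(3) = 2` on both engines, same subspace; cert `a8f8b7e93b5a…`; kit j091546). Per pair; OFFER (the
desk books); class X8 and crux 5 unchanged. [cite: Wuthrich2014, Prop. 21 (p. 400)]
[cite: SilvermanAEC2009, Thm. X.4.14 and VII.1 Remark 1.1] [cite: Miller2011LMS, §1 and Def. 1.1]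
[cite: Cremona2006, Table 1 (Cremona label 15680bb1)] -/
theorem X8.bsdp3_sel9_15680bb1 (hCT : exists_casselsTate_pairing (K := ℚ)) (hW : sha_dvd_analyticSha)
    (hGZK : rank_eq_analyticRank_of_analyticRank_le_one) (hmod : hasEntireLFunction_rat)
    (W : WeierstrassCurve ℚ) (hWm : W = ⟨0, 0, 0, 6272, -581728⟩) (hr : W.analyticRank = 0)
    {q : ℚ} (hq : shaAn W = (q : ℂ)) (hv : padicValRat 3 q ≤ 2) (hSel : W.selmerGroup (3 : ℤ) ≠ ⊥) :
    BSDp W 3 := by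
  subst hWm
  exact X8.bsdp_three_rankZero_of_ainvs_of_selmerGroup_ne_bot_of_surj hCT hW hGZK hmod
    0 0 0 6272 (-581728)
    (isGloballyMinimal_of_krausCriterion₃_bounded 0 0 0 6272 (-581728)
      (by decide +kernel) (by decide +kernel)
      (by set_option synthInstance.maxSize 2000 in decide +kernel))
    (by decide) (n₃ := 1) (by decide +kernel) (by decide) surj_x8r0_15680bb1_3 hr hq hv hSel

/-- **`BSD(E,3)` for `15680y1`** — X8 ∩ {r_an = 0} ∩ {surj(3)}, `#Ш_an = 9`; Cremona model `[0,0,0,366422,-83755798]`,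
`N = 15680 = 2⁶·5·7²`, good supersingular at `3` with `a₃ = 3`, `ρ̄_{E,3}` onto (`surj_x8r0_15680y1_3`), `#E(ℚ)_tors = 1`,
`∏ c_ℓ = 4`. Kernel-decided: global minimality (the bounded Kraus certificate of `surj_x8r0_15680y1_3`, verbatim), `3 ∤ Δ`, `#Ẽ(𝔽₃) = 1`. Binders: PUBLISHED `hCT`,
`hW`, `hGZK`, `hmod`; per pair `hr`, `hq`/`hv` (`#Ш_an = 9`), `hSel : Sel^(3)(E/ℚ) ≠ ⊥` — EVIDENCE: the landed
two-engine exact `3`-descent row of `15680y1` in `Supersingular/X8DescentRecords.lean` (`checked_x8_rankZero_sha9_desc3_3`;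
`dim_𝔽₃ Sel^(3) = 2` on both engines, same subspace; cert `82ee8801ef0b…`; kit j091546). Per pair; OFFER (the
desk books); class X8 and crux 5 unchanged. [cite: Wuthrich2014, Prop. 21 (p. 400)]
[cite: SilvermanAEC2009, Thm. X.4.14 and VII.1 Remark 1.1] [cite: Miller2011LMS, §1 and Def. 1.1]
[cite: Cremona2006, Table 1 (Cremona label 15680y1)] -/
theorem X8.bsdp3_sel9_15680y1 (hCT : exists_casselsTate_pairing (K := ℚ)) (hW : sha_dvd_analyticSha)
    (hGZK : rank_eq_analyticRank_of_analyticRank_le_one) (hmod : hasEntireLFunction_rat)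
    (W : WeierstrassCurve ℚ) (hWm : W = ⟨0, 0, 0, 366422, -83755798⟩) (hr : W.analyticRank = 0)
    {q : ℚ} (hq : shaAn W = (q : ℂ)) (hv : padicValRat 3 q ≤ 2) (hSel : W.selmerGroup (3 : ℤ) ≠ ⊥) :
    BSDp W 3 := by
  subst hWm
  exact X8.bsdp_three_rankZero_of_ainvs_of_selmerGroup_ne_bot_of_surj hCT hW hGZK hmod
    0 0 0 366422 (-83755798)
    (isGloballyMinimal_of_krausCriterion_bounded 0 0 0 366422 (-83755798)
      (by decide +kernel) (by decide +kernel) (by decide +kernel))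
    (by decide) (n₃ := 1) (by decide +kernel) (by decide) surj_x8r0_15680y1_3 hr hq hv hSel

/-- **`BSD(E,3)` for `15686f1`** — X8 ∩ {r_an = 0} ∩ {surj(3)}, `#Ш_an = 9`; Cremona model `[1,-1,1,-27,-47]`,
`N = 15686 = 2·11·23·31`, good supersingular at `3` with `a₃ = 3`, `ρ̄_{E,3}` onto (`surj_x8r0_15686f1_3`), `#E(ℚ)_tors = 1`,
`∏ c_ℓ = 1`. Kernel-decided: global minimality (the bounded Kraus certificate of `surj_x8r0_15686f1_3`, verbatim), `3 ∤ Δ`, `#Ẽ(𝔽₃) = 1`. Binders: PUBLISHED `hCT`,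
`hW`, `hGZK`, `hmod`; per pair `hr`, `hq`/`hv` (`#Ш_an = 9`), `hSel : Sel^(3)(E/ℚ) ≠ ⊥` — EVIDENCE: the landed
two-engine exact `3`-descent row of `15686f1` in `Supersingular/X8DescentRecords.lean` (`checked_x8_rankZero_sha9_desc3_3`;
`dim_𝔽₃ Sel^(3) = 2` on both engines, same subspace; cert `4d9881770ef5…`; kit j091546). Per pair; OFFER (the
desk books); class X8 and crux 5 unchanged. [cite: Wuthrich2014, Prop. 21 (p. 400)]
[cite: SilvermanAEC2009, Thm. X.4.14 and VII.1 Remark 1.1] [cite: Miller2011LMS, §1 and Def. 1.1]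
[cite: Cremona2006, Table 1 (Cremona label 15686f1)] -/
theorem X8.bsdp3_sel9_15686f1 (hCT : exists_casselsTate_pairing (K := ℚ)) (hW : sha_dvd_analyticSha)
    (hGZK : rank_eq_analyticRank_of_analyticRank_le_one) (hmod : hasEntireLFunction_rat)
    (W : WeierstrassCurve ℚ) (hWm : W = ⟨1, -1, 1, -27, -47⟩) (hr : W.analyticRank = 0)
    {q : ℚ} (hq : shaAn W = (q : ℂ)) (hv : padicValRat 3 q ≤ 2) (hSel : W.selmerGroup (3 : ℤ) ≠ ⊥) :
    BSDp W 3 := by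
  subst hWm
  exact X8.bsdp_three_rankZero_of_ainvs_of_selmerGroup_ne_bot_of_surj hCT hW hGZK hmod
    1 (-1) 1 (-27) (-47)
    (isGloballyMinimal_of_krausCriterion_bounded 1 (-1) 1 (-27) (-47)
      (by decide +kernel) (by decide +kernel) (by decide +kernel))
    (by decide) (n₃ := 1) (by decide +kernel) (by decide) surj_x8r0_15686f1_3 hr hq hv hSel

/-- **`BSD(E,3)` for `16019a1`** — X8 ∩ {r_an = 0} ∩ {surj(3)}, `#Ш_an = 9`; Cremona model `[1,-1,0,-100,-361]`,
`N = 16019 = 83·193`, good supersingular at `3` with `a₃ = 3`, `ρ̄_{E,3}` onto (`surj_x8r0_16019a1_3`), `#E(ℚ)_tors = 1`,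
`∏ c_ℓ = 1`. Kernel-decided: global minimality (the bounded Kraus certificate of `surj_x8r0_16019a1_3`, verbatim), `3 ∤ Δ`, `#Ẽ(𝔽₃) = 1`. Binders: PUBLISHED `hCT`,
`hW`, `hGZK`, `hmod`; per pair `hr`, `hq`/`hv` (`#Ш_an = 9`), `hSel : Sel^(3)(E/ℚ) ≠ ⊥` — EVIDENCE: the landed
two-engine exact `3`-descent row of `16019a1` in `Supersingular/X8DescentRecords.lean` (`checked_x8_rankZero_sha9_desc3_3`;
`dim_𝔽₃ Sel^(3) = 2` on both engines, same subspace; cert `10ba221b2865…`; kit j091546). Per pair; OFFER (the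
desk books); class X8 and crux 5 unchanged. [cite: Wuthrich2014, Prop. 21 (p. 400)]
[cite: SilvermanAEC2009, Thm. X.4.14 and VII.1 Remark 1.1] [cite: Miller2011LMS, §1 and Def. 1.1]
[cite: Cremona2006, Table 1 (Cremona label 16019a1)] -/
theorem X8.bsdp3_sel9_16019a1 (hCT : exists_casselsTate_pairing (K := ℚ)) (hW : sha_dvd_analyticSha)
    (hGZK : rank_eq_analyticRank_of_analyticRank_le_one) (hmod : hasEntireLFunction_rat)
    (W : WeierstrassCurve ℚ) (hWm : W = ⟨1, -1, 0, -100, -361⟩) (hr : W.analyticRank = 0)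
    {q : ℚ} (hq : shaAn W = (q : ℂ)) (hv : padicValRat 3 q ≤ 2) (hSel : W.selmerGroup (3 : ℤ) ≠ ⊥) :
    BSDp W 3 := by
  subst hWm
  exact X8.bsdp_three_rankZero_of_ainvs_of_selmerGroup_ne_bot_of_surj hCT hW hGZK hmod
    1 (-1) 0 (-100) (-361)
    (isGloballyMinimal_of_krausCriterion_bounded 1 (-1) 0 (-100) (-361)
      (by decide +kernel) (by decide +kernel) (by decide +kernel))
    (by decide) (n₃ := 1) (by decide +kernel) (by decide) surj_x8r0_16019a1_3 hr hq hv hSel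

/-- **`BSD(E,3)` for `16562r1`** — X8 ∩ {r_an = 0} ∩ {surj(3)}, `#Ш_an = 9`; Cremona model `[1,-1,0,-22255,-1949011]`,
`N = 16562 = 2·7²·13²`, good supersingular at `3` with `a₃ = 3`, `ρ̄_{E,3}` onto (`surj_x8r0_16562r1_3`), `#E(ℚ)_tors = 1`,
`∏ c_ℓ = 2`. Kernel-decided: global minimality (the bounded Kraus certificate of `surj_x8r0_16562r1_3`, verbatim), `3 ∤ Δ`, `#Ẽ(𝔽₃) = 1`. Binders: PUBLISHED `hCT`,
`hW`, `hGZK`, `hmod`; per pair `hr`, `hq`/`hv` (`#Ш_an = 9`), `hSel : Sel^(3)(E/ℚ) ≠ ⊥` — EVIDENCE: the landed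
two-engine exact `3`-descent row of `16562r1` in `Supersingular/X8DescentRecords.lean` (`checked_x8_rankZero_sha9_desc3_4`;
`dim_𝔽₃ Sel^(3) = 2` on both engines, same subspace; cert `72fac7f3fbbf…`; kit j091546). Per pair; OFFER (the
desk books); class X8 and crux 5 unchanged. [cite: Wuthrich2014, Prop. 21 (p. 400)]
[cite: SilvermanAEC2009, Thm. X.4.14 and VII.1 Remark 1.1] [cite: Miller2011LMS, §1 and Def. 1.1]
[cite: Cremona2006, Table 1 (Cremona label 16562r1)] -/
theorem X8.bsdp3_sel9_16562r1 (hCT : exists_casselsTate_pairing (K := ℚ)) (hW : sha_dvd_analyticSha)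
    (hGZK : rank_eq_analyticRank_of_analyticRank_le_one) (hmod : hasEntireLFunction_rat)
    (W : WeierstrassCurve ℚ) (hWm : W = ⟨1, -1, 0, -22255, -1949011⟩) (hr : W.analyticRank = 0)
    {q : ℚ} (hq : shaAn W = (q : ℂ)) (hv : padicValRat 3 q ≤ 2) (hSel : W.selmerGroup (3 : ℤ) ≠ ⊥) :
    BSDp W 3 := by
  subst hWm
  exact X8.bsdp_three_rankZero_of_ainvs_of_selmerGroup_ne_bot_of_surj hCT hW hGZK hmod
    1 (-1) 0 (-22255) (-1949011)
    (isGloballyMinimal_of_krausCriterion_bounded 1 (-1) 0 (-22255) (-1949011)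
      (by decide +kernel) (by decide +kernel) (by decide +kernel))
    (by decide) (n₃ := 1) (by decide +kernel) (by decide) surj_x8r0_16562r1_3 hr hq hv hSel

end Summit.BirchSwinnertonDyer.BirchSwinnertonDyer.Theorems

end
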